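/-
Copyright (c) 2026 the pub-hodgecm-mathlib formalisation cell (harness21).  Planner seat hodgecm-mathlib-LH4-plan (g2): line LH4 — PAY-DOWN SKELETON CAND (HOME-only) of the
post-ED.39 PRINT row `stub_N6nsShalika` (Shalika germ expansion at the identity for `U(Φ₃)(L⁺_v)`), cut as the HOWE PACKAGE at the ODD non-split places; 2026-09-02.
-/
import Literature.NumberTheory.Rogawski1990.ShalikaGermExpansionHoweReduction          -- ★ p848172 SH-3 (LH4-p03 (g0)): THE PLUG `UnitaryGroup.shalikaGermExpansionNonsplit_of_howePackage` (brings SH-1 ★ p848018, SH-2 ★ p848037, the local currency)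
import Literature.NumberTheory.Rogawski1990.UnipotentOrbitalIntegralDualPiecesCM          -- ★ p849114 ‹DUAL› organ PAID (LH4-p02 (g2))
import Literature.NumberTheory.Rogawski1990.UnitaryThreeUnipotentClassesFiniteCM          -- ★ p849177 ‹U-FIN› organ PAID (LH5-p02 (g2))
import Literature.NumberTheory.Rogawski1990.LocalTransferIdentityCoreResidualStatementsOdd  -- ★ p849113 (LH4-p02 (g2)): `N6nsShalikaOddStatement` — the NARROWED row type BY NAME (desk condition (c))
import Literature.NumberTheory.Rogawski1990.UnipotentOrbitalMeasuresExistCM             -- ★ p849138 RAO-EX (LH3-p02 (g0)): `…exists_orbitalMeasureFamily_isAdmissibleOn_unipotent_antidiagOne_three_odd`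
import Literature.NumberTheory.Rogawski1990.UnipotentOrbitalMeasuresExistUncondCM        -- ★ p849258 RAO-EX-UNCOND (LH4-p03 (g3)): `…_odd'` (existence with `hcent` discharged by ★ p849215 CENT-BDD)
import Literature.NumberTheory.Rogawski1990.UnipotentOrbitalIntegralConvergenceCM         -- ★ p849278 FILE 4 ED. 1 (LH7-p01 (g2)): the three-way split `…_of_unipotent_of_cases` (`γ = 1` case proved inside)
import Literature.NumberTheory.Rogawski1990.UnipotentOrbitalIntegralConvergenceSingularCM -- ★ p849351 (LH10-p01 (g2)): `UnitaryGroup.integrable_descConj_of_isLocSmooth_of_transvection` (singular case, hypothesis-free, over ★ p849314 + ★ p849303)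
import Literature.NumberTheory.Rogawski1990.UnipotentOrbitalIntegralConvergenceRegularCM  -- ★ p849508 (C) ED. 3 (LH7-p01 (g2)): `UnitaryGroup.integrable_descConj_of_isLocSmooth_of_regular_unipotent` (regular case, hypothesis-free, over ★ (I)(II)(II-S)(B)(A1)(A2) + ★ p849303)
import Literature.MeasureTheory.Group.OrbitalIntegralKernelDecomposition                  -- ★ p849233 SPAN-e FILE B (LH7-p01 (g2)): `exists_add_mem_span_conj_sub_of_classOrbitalIntegral_eq_zero` (Howe's span property, generic)
import Literature.NumberTheory.Rogawski1990.UnitaryThreeUnipotentClosedFiltrationCM    -- ★ p849265 (LH3-p02 (g0)): `exists_enum_unipotent_isClosed_iUnion_lt_antidiagOne_odd` (= `hfilt`, over ★ p849223 (S1)(S2) + ★ p849243), `npow_conj_sub_one_eq_zero_iff`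
import Literature.NumberTheory.Rogawski1990.LocalTransferGlueCM                        -- ★ `totallyDisconnectedSpace_cmDatum_local` (SPAN-TIE glue)
import Literature.NumberTheory.Automorphic.AdicCompletionIntegerSpellings             -- ★ p849331 «𝒪-BRIDGE» (LH3-p02 (g0)): `isUnit_two_valuedInteger_of_isUnit_two` (leaf dialect `ValuativeRel` → `Valued`)
import Literature.NumberTheory.Automorphic.LocalUnitaryGroupCongr                       -- ★ `antidiagOne_isHermitian`, `isUnit_antidiagOne_det` (`Φ₃` hermitian, `det Φ₃ ≠ 0`)
import HarnessLib

/-!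
SKELETON CAND v7o (2026-09-02 ≈08:00Z, LH10-p01 (g2), LH4-plan (g2) DEALER WORDS #59 (i); = LEAF ED. 1 candidate): = v7 57966d5b79b71a6d MINUS §3 (the dyadic VARIANT head:
`stub_ShDyadic`, `n6nsShalika_of_organs_of_dyadic`, `stub_N6nsShalika_of_organs` — no consumer; the dyadic places are the closer's separate row «DYADIC», ED. 39 §2‴ swap) and minus the import
of ★ p847938 `LocalTransferIdentityCoreResidualStatements` (only §3 used `N6nsShalikaStatement`).  SORRIES 0: every organ ★, heads `n6nsShalikaOdd_of_organs` ∕ `stub_N6nsShalikaOdd_of_organs` ∕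
`stub_N6nsShalikaOdd_paid : N6nsShalikaOddStatement` TRIO; kept organ statements + heads byte-identical to v7.
v7 (2026-09-02 ≈07:30Z, LH10-p01 (g2), LH4-plan (g2) DEALER WORDS #57 (i)): = v7a 1798e557809bc8e0 + import ★ p849508 `UnipotentOrbitalIntegralConvergenceRegularCM`
+ `stub_RaoRegular := UnitaryGroup.integrable_descConj_of_isLocSmooth_of_regular_unipotent` (bare name; statement byte-identical).  SORRIES 1 = {`stub_ShDyadic` (PRINT, dyadic places,
needed by no consumer)}: EVERY in-house organ of the Shalika pay-down at odd places is ★ — ‹U-FIN› p849177, ‹RAO› = existence p849258 + convergence {singular p849351, regular p849508}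
through ★ p849278's split, ‹DUAL› p849114, ‹SPAN› p849233 + p849265 glue; `stub_N6nsShalikaOdd_paid : N6nsShalikaOddStatement` is TRIO.
v7a (2026-09-02 ≈07:00Z, LH10-p01 (g2); ED. 1 CANDIDATE OF RECORD per LH4-plan (g2) DEALER WORDS #49): = v7pre be677cac629eb6d1 + import ★ p849113
`LocalTransferIdentityCoreResidualStatementsOdd` + `theorem stub_N6nsShalikaOdd_paid : N6nsShalikaOddStatement := stub_N6nsShalikaOdd_of_organs` (the paid head BY NAME, desk condition (c)).
Sorries 2 = {`stub_RaoRegular` (the ONE open in-house organ), `stub_ShDyadic` (print)}; ED. 2 (v7) = `stub_RaoRegular := UnitaryGroup.integrable_descConj_of_isLocSmooth_of_regular_unipotent` when (C) ED. 3 ★.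
v7pre (2026-09-02 ≈06:30Z, LH10-p01 (g2); HOME rehearsal, NO filing): = v6b 0285578a4b8f2e6a with ‹RAO-CONV› NARROWED TO THE REGULAR CLASS — `stub_RaoConv` (FILE 4 head)
PROVED from the NEW narrower sorried organ `stub_RaoRegular` (= ★ p849278's `hregCase` text = LH5-p02's regular head of record) and the ★ SINGULAR case p849351 through ★ p849278's
three-way split; sorries 2 = {`stub_RaoRegular`, `stub_ShDyadic` (print)}.  v7 proper = `stub_RaoConv := <FILE 4 ED. 2 head>` when ★ (then `stub_RaoRegular` leaves).
v6b (= v6 with the inline 3-line `𝒪` bridge replaced by the ★ p849331 term `isUnit_two_valuedInteger_of_isUnit_two L w.1 h2`; import `AdicCompletionIntegerSpellings`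
replaces `AdicCompletionIntegersAdicComplete`; = LH3-p02's SPAN-TIE v3 e93e35fdb76cfa84 body verbatim).
v6 (2026-09-02 ≈06:00Z, LH10-p01 (g2), LH4-plan (g2) DEALER WORDS #32 (c); HOME rehearsal, NO filing): = v5 f8f40c17dde7fc88 with LH3-p02's pasted SPAN-TIE glue
(§0a–§0c, ≈300 l.) and the inline §0d bridge lemma REPLACED BY IMPORTS — ★ p849265 `UnitaryThreeUnipotentClosedFiltrationCM` (`hfilt` unconditional) — the 8-line TIE body of
LH3-p02's rehearsal v2 72e04e1569450791 now sits inside `stub_ShSpan_of_spanE` (3-line `𝒪` bridge inline until ★ `AdicCompletionIntegerSpellings`).  Sorries 2 unchanged.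
v5 (2026-09-02 ≈05:30Z, LH10-p01 (g2), LH4-plan (g2) DEALER WORDS #23 (b); HOME rehearsal, NO filing): = v4 aac75d883879c2fc + (i) `stub_SpanE` DISCHARGED by ★ p849233
`exists_add_mem_span_conj_sub_of_classOrbitalIntegral_eq_zero` (LH7-p01 (g2); telescope token for token, `intro; exact`), (ii) ‹RAO› existence by ★ p849258 `…_odd'` (one `obtain`).  Digits: rc 0,
sorries 2 = {`stub_RaoConv` (F0P3a-p09∕LH7-p01 FILE 4 head), `stub_ShDyadic` (print)}; LH3-p02's §0a–§0c paste kept until their §2 filtration file is ★ (then v6 = swap to imports).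
v4 (2026-09-02 ≈05:00Z, LH10-p01 (g2) «SKEL-v4 MERGE», LH4-plan (g2) DEALER WORDS #17 (a); HOME rehearsal, NO filing): = v3 03663f5859956abd with BOTH in-house organs
RE-CUT TO THEIR ONE REMAINING SORRIED HALF — (i) ‹RAO›: `stub_ShRao` (sorried in v1–v3) ↦ `stub_RaoConv : HCONV := by sorry` (F0P3a-p09 (g4)'s FILE 4 head, text = LH3-p02 (g0)'s
RAO-TIE rehearsal 779faa6f `hconv` binder verbatim) + `stub_ShRao_of_conv` PROVED (★ p849138 RAO-EX §3 `…_odd` ∘ ★ p849215 CENT-BDD `exists_isCompact_subgroup_of_mem_centralizer_unipotent`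
∘ `stub_RaoConv`; LH3-p02's glue); (ii) ‹SPAN›: `stub_ShSpan` ↦ `stub_SpanE : HE := by sorry` (LH7-p01 (g2)'s SPAN-e FILE B head ∀-closed over `G`, text = LH3-p02's SPAN-TIE
rehearsal e342085f `hE` binder verbatim) + `stub_ShSpan_of_spanE` PROVED (LH3-p02's SPAN-TIE glue §0a–§0c PASTED VERBATIM with credit — to be swapped for imports of
★ `Literature/Topology/ClosedFiltrationEnumeration` + ★ `Rogawski1990/UnitaryThreeUnipotentClosedFiltrationCM` when they land — fed with ★ p849223 U3-STRATA (S1)∕(S2) through the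
§0d SPELLING BRIDGE `isUnit_two_valuedInteger_of_isUnit_two`: this leaf and ★ p849138 spell `𝒪[L_w]` as `(ValuativeRel.valuation L_w).integer` (`open scoped ValuativeRel`), ★ p849223
as `Valued.integer L_w` (`open scoped Valued`) — the binder `IsUnit (2 : 𝒪[L_w])` must be transported, ★ `integer_valuation_eq_valuedInteger`); (iii) heads unchanged, closers re-pointed
(`stub_ShRao_of_conv`, `stub_ShSpan_of_spanE`).  Digits: rc 0, sorries 3 = {`stub_RaoConv`, `stub_SpanE`, `stub_ShDyadic` (print)}; `n6nsShalikaOdd_of_organs` TRIO.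
v3 (2026-09-02 04:33Z, LH4-plan (g2)): = v2 dfbda26f60562b55 + ‹U-FIN› organ TIED by `exact` on ★ p849177
`Literature.NumberTheory.Rogawski1990.unitaryThree_unipotent_conjClasses_finite_odd` (sorries 4 → 3 = {ShRao, ShSpan, ShDyadic = print}).  v2 = v1 a42538b59ca1b043 + ‹DUAL› organ TIED by `exact` on ★ p849114
`Literature.NumberTheory.Rogawski1990.UnitaryGroup.exists_unipotentDualPieces_antidiagOne_odd` (sorries 5 → 4); all statement texts byte-identical to v1.

# `StubN6nsShalika.paydown.skeleton.v1` — PAY-DOWN SKELETON CAND of the print row `stub_N6nsShalika` (germ «N6nsGerm» ED. 1.17 «α» binder `hsh` ∕ closer ED. 39 §2‴ row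
# `stub_N6nsShalika : N6nsShalikaStatement`), cut as ‹U-FIN› + ‹RAO› + ‹DUAL› + ‹SPAN› at the ODD places through the ★ SH-3 plug

Cell `hodgecm-mathlib` (HCML «GO 500», SEATPLAN-GO500.v1 §1B row LH4), half A line LH4, crux H413 (`stmt-HodgeConjecture-24833`), route of record `HCCMUnconditional`.  Planner LH4-plan
(g2).  HOME-first: `F0/P3c/LH4/LH4-plan/g2/shalika/StubN6nsShalika.paydown.skeleton.v1.LH4plang2.lean`; written to `Cruxes/H413/Lines/F0_P3c_ShalikaPaydown.lean` ONLY on the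
desk's word (heir desk F0P3-plan (g14) ∕ LEAD F0P3a-plan (g13); LEAD T12-23: layer 2 parked until ED. 1.17).  NO registry act.  PRICING INPUT, not a deal.

THE ROW.  After ED. 39 §2‴ (SWAP 7 → 8 BY NAME) the closer carries `stub_N6nsShalika : Literature.NumberTheory.Rogawski1990.N6nsShalikaStatement` =
`∀ L (CM) v, Subsingleton (PlacesOver L v) → ShalikaGermExpansionNonsplit L Φ₃ v` — PRINT [Rogawski1990 Prop. 8.1.1] (Harish-Chandra ∕ Shalika ∕ Ranga Rao).
«RESIDUAL NARROWING» (this seat, cand `LocalTransferIdentityCoreResidualStatementsOdd` sha16 2d6ec7091b38eaa9, GREEN): the three-way split ★ p847670 consumes the germ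
expansion ONLY at the places `v ∤ 2`; the honest row is `N6nsShalikaOddStatement` (extra binder `w ∣ v`, hypothesis `IsUnit (2 : 𝒪_w)`), and THIS skeleton pays THAT row.
For the row of record AS TYPED (all non-split `v`) the variant head `n6nsShalika_of_organs_of_dyadic` adds the organ `stub_ShDyadic` (Shalika at `Φ₃` at the DYADIC non-split
places — print, permanent, NEEDED BY NO CONSUMER: the desk should rather adopt the narrowing than register it).

THE CUT — the HOWE PACKAGE of the ★ SH-3 plug `UnitaryGroup.shalikaGermExpansionNonsplit_of_howePackage (hH′) (hdet) (h)` (p848172; `h = ∃ S mU fd`, seven conjuncts: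
unipotent ∕ admissible ∕ Rao ∕ loc-smooth ∕ dual (×2) ∕ SPAN) re-cut as FOUR BY-NAME ORGANS, each a stand-alone statement about `G = U(Φ₃)(L⁺_v)` at an odd non-split place
(`sorry` ONLY inside `stub_*`; every organ text elaborates against the tree's currency — `cmDatum … .Local`, `OrbitalMeasureFamily`, `IsAdmissibleOn`, `descConj`,
`classOrbitalIntegral`, `IsLocSmooth`):
* `stub_ShUFin`  ‹U-FIN› (IN-HOUSE, M): the unipotent conjugacy classes of `G` form a FINITE set `S` (`c ∈ S ↔ (γ_c − 1)³ = 0`).  Road: the tree's classification at odd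
  places — FOUR classes `1`, `[n(ϖδ)]`, `[n(δ)]`, regular (★ `sq_zero_unipotent_cases` + ★ `exists_conj_eq_of_regular_unipotent` at unramified `v`; ★
  `sq_zero_unipotent_cases_of_ramified_complexConj` ∕ ★ `not_exists_conj_cornerUnipotent_of_ramified_complexConj` at tame `v`) transported through the frame ★
  `UnipotentLevelPiecesFrameCM` (`ψ = T·e(·)·T⁻¹ : G ≅ U(σ_w, J₀)(L_w)`).  [Rogawski1990 §3.9 Prop. 3.9.1 p. 32]
* `stub_ShRao`   ‹RAO› (IN-HOUSE, L–XL; PRINT basis [Rao1972]): an orbital-measure family `mU` ADMISSIBLE at every unipotent class (non-zero, `G`-invariant, finite on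
  compacts on `G ⧸ G_u`) with the RANGA-RAO CLAUSE «`y ↦ f(y u y⁻¹)` is `mU u`-integrable for every `f ∈ C_c^∞(G)`».  Road: EXISTENCE by ★ `InvariantQuotientExistence`
  (`quotientMeasure`, `smulInvariantMeasure_quotientMeasure`, `quotientMeasure_ne_zero`, `isFiniteMeasureOnCompacts_quotientMeasure`) once the three centraliser types are
  shown UNIMODULAR (`G_1 = G`; `G_u = E¹×E¹ ⋉ N` (compact ⋉ Heisenberg) for the transvections; `G_u = Z(G)·C_N(u)` (compact × abelian) for the regular class) — layer-2
  organs RAO-a (centralisers, algebra, M) ∕ RAO-b (unimodularity of compact-by-nilpotent, M); CONVERGENCE (= the orbit measures are RADON ON `G`, finite mass near the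
  boundary strata) — layer-2 organ RAO-c (L–XL): `K`-orbit decomposition of `O_u ∩ K` by level (★ FILE 1 `exists_conj_cornerUnipotent_of_v_eq_mul_exp` ∕ ★ FILE 0
  `IntMatrixLevelConjugation`) + the scaling law of the transported Haar measure of `G_u` under `Ad` of the split torus (mass of the level-`m` `K`-class `∝ q^{-2m}`,
  a geometric series) — NO Iwasawa decomposition needed.  [Rao1972, Thm.; Rogawski1990 §8.1 p. 112; HarishChandra1999AdmissibleDistributions §3.1 p. 17]
* `stub_ShDual`  ‹DUAL› (IN-HOUSE, M at odd places): DUAL PIECES `fd u ∈ C_c^∞(G)` with `Φ_{mU}(u, fd u′) = δ_{u u′}` for any finite set `S` of unipotent classes and any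
  `mU` admissible on `S` with the Rao clause.  Road: ★ RANK `exists_levelPieces_det_classOrbitalIntegral_ne_zero` (unramified) ∕ ★ `UnipotentOrbitalIntegralLevelPiecesRamifiedCM`
  + `…RamifiedLevelOneCM` (tame) give reference pieces with `det (Φ(u, g_{u′})) ≠ 0`; ★ p848130 `OrbitalIntegralDualPieces` inverts the matrix.  [Rogawski1990 §8.1 p. 113 l. 1–6]
* `stub_ShSpan`  ‹SPAN› (IN-HOUSE, L; PRINT basis [Howe1974 Prop. 2] ∕ [HarishChandra1999AdmissibleDistributions Thm. 8.1]): HOWE'S SPAN PROPERTY — an `F ∈ C_c^∞(G)` all of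
  whose unipotent orbital integrals vanish is `F₀ + F₁` with `F₀` in the `ℂ`-span of the `φ^x − φ` and `tsupport F₁` off the unipotent variety.  Road (ELEMENTARY for a FINITE
  orbit stratification, no Howe conjecture): layer-2 organs SPAN-a ‹COINV-1› (generic `l`-space lemma, M–L: on ONE orbit `O` carrying a `G`-invariant measure `μ_O` positive on
  open sets, `ψ ∈ C_c^∞(O)` with `∫ ψ dμ_O = 0` lies in the span of the `φ^x − φ` — indicator combinatorics of `K`-orbits for a small compact open `K`), SPAN-b ‹ORBIT-OPEN›
  (generic Baire lemma, M: the orbit map `G → O` is OPEN onto a locally closed orbit; `BaireSpace` of locally compact `O`, `σ`-compact `G`), SPAN-c ‹U3-STRATA› (M: `{1} ⊂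
  {(γ−1)² = 0} ⊂ {(γ−1)³ = 0}` closed `Ad`-stable, successive differences = finite disjoint unions of relatively OPEN single orbits — the norm-class invariant of a transvection
  is locally constant because `N(E^×) ⊇ (F^×)²` is open at ODD residue characteristic), SPAN-d ‹LIFT› (S: restriction `C_c^∞(G) → C_c^∞(Z)` onto a closed `Ad`-stable `Z` is
  surjective and `Ad`-equivariant — ★ `Literature/Topology/LocallyConstantExtend` `exists_isLocallyConstant_hasCompactSupport_extend` + extension by zero), SPAN-e
  ‹INDUCTION› (M: right-exactness of coinvariants along the three strata; `Φ(u, φ^x − φ) = 0` by invariance + the Rao clause = ★ SH-2 `classOrbitalIntegral_eq_zero_of_mem_span_conj_sub`).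
  [Howe1974, Prop. 2; HarishChandra1999AdmissibleDistributions, Thm. 8.1 p. 48; BernsteinZelevinsky1976 §1; Rogawski1990 §8.1 pp. 112–113]
* `stub_ShDyadic` (variant head only; PRINT, permanent, XL, consumed by nobody): Shalika at `Φ₃` at the DYADIC non-split places.  [Rogawski1990 Prop. 8.1.1]
HEADS (PROVED, kernel-checked compositions; no `sorry` outside `stub_*`):
* `n6nsShalikaOdd_of_organs : ‹U-FIN› → ‹RAO› → ‹DUAL› → ‹SPAN› → ‹N6nsShalikaOddStatement text›` — assemble the Howe package at `(L, v)` and apply the ★ SH-3 plug with ★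
  `antidiagOne_isHermitian L 3`, ★ `(isUnit_antidiagOne_det L 3).ne_zero`; `stub_N6nsShalikaOdd_of_organs` = it over the four stubs (closes the NARROWED row by `exact`).
* `n6nsShalika_of_organs_of_dyadic : ‹U-FIN› → ‹RAO› → ‹DUAL› → ‹SPAN› → ‹DYADIC-SHALIKA› → N6nsShalikaStatement` (row of record as typed; by cases on `IsUnit (2 : 𝒪_w)`);
  `stub_N6nsShalika_of_organs` = it over the five stubs.
p-UNIFORMITY: every organ is stated and (roads above) provable uniformly at ALL odd non-split places (unramified and tame ramified); nothing is special to `v ∤ 2` except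
SPAN-c's openness of norms and the ★ coverage of U-FIN ∕ DUAL.  SIZES (layer 2 included): U-FIN M · RAO L–XL (RAO-c is the one hard analytic organ) · DUAL M · SPAN L (five
M-or-smaller generic∕algebraic organs) — ≈ 8–10 prover hands × 1–2 gens; the generic organs (COINV-1, ORBIT-OPEN, LIFT, compact-by-nilpotent unimodularity) are reusable
Literature (`MeasureTheory/Group`, `Topology`).
HONEST LABEL: HC_CM is proved only modulo the 7 printed citations (2 remaining named inputs: hLiu418 = stmt-HodgeConjecture-24832, h413 = stmt-HodgeConjecture-24833) until
rung 0 closes.  This skeleton discharges NOTHING printed: its heads are conditional on the sorried organs; the row `stub_N6nsShalika` stays print until every organ is ★.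

## References
* [Rogawski1990] J. D. Rogawski, *Automorphic Representations of Unitary Groups in Three Variables*, Ann. of Math. Stud. 123 (1990): §8.1 Props. 8.1.1–8.1.2 pp. 112–114; §3.9
  Prop. 3.9.1 p. 32; §4.9 p. 54; §1.6 p. 6.
* [Rao1972] R. Ranga Rao, *Orbital integrals in reductive groups*, Ann. of Math. (2) 96 (1972) 505–510.
* [Howe1974] R. Howe, *The Fourier transform and germs of characters (case of GL_n over a p-adic field)*, Math. Ann. 208 (1974) 305–322, Prop. 2.
* [HarishChandra1999AdmissibleDistributions] Harish-Chandra (notes by S. DeBacker, P. J. Sally, Jr.), *Admissible Invariant Distributions on Reductive p-adic Groups*, AMS ULS 16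
  (1999): Thm. 8.1 p. 48; §3.1 p. 17.
* [BernsteinZelevinsky1976] I. N. Bernstein, A. V. Zelevinsky, *Representations of the group GL(n, F) where F is a non-archimedean local field*, Russian Math. Surveys 31:3
  (1976) 1–68: §1 (l-spaces, distributions, §1.5 orbits), §6.
-/

set_option autoImplicit false
set_option linter.dupNamespace false
set_option linter.unusedVariables false

noncomputable section

namespace Summit.HodgeConjecture.HodgeConjecture.Cruxes.H413.F0P3cShalikaPaydown

open MeasureTheory Measure NumberField IsDedekindDomain Topology Filter
open Literature.MeasureTheory.Group Literature.NumberTheory.Automorphic Literature.NumberTheory.Automorphic.UnitaryGroup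
open Literature.NumberTheory.Rogawski1990 Literature.NumberTheory.GaloisRepresentations
open scoped Matrix MatrixGroups Classical ValuativeRel

/-! ## §1 The four organs (ODD non-split places) -/

/-- **ORGAN ‹U-FIN› `stub_ShUFin` (IN-HOUSE, M)** — at an odd non-split place the unipotent conjugacy classes of `G = U(Φ₃)(L⁺_v)` form a finite set: `c ∈ S ↔ (γ_c − 1)³ = 0`
(four classes `1`, `[n(ϖδ)]`, `[n(δ)]`, regular — ★ `sq_zero_unipotent_cases`, ★ `exists_conj_eq_of_regular_unipotent`, ★ `sq_zero_unipotent_cases_of_ramified_complexConj` through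
the frame ★ `UnipotentLevelPiecesFrameCM`).
[cite: Rogawski1990, §3.9 Prop. 3.9.1 p. 32; §8.1 p. 112] -/
theorem stub_ShUFin :
    ∀ (L : Type) [Field L] [NumberField L] [IsCMField L] (v : HeightOneSpectrum (𝓞 ↥(maximalRealSubfield L))) (w : UnitaryGroup.PlacesOver L v),
      Subsingleton (UnitaryGroup.PlacesOver L v) → IsUnit (2 : 𝒪[w.1.adicCompletion L]) →
      ∃ S : Finset (ConjClasses ((cmDatum L 3 (Matrix.of fun i j : Fin 3 => if i.val + j.val + 1 = 3 then (1 : L) else 0)).Local v)), ∀ c : ConjClasses ((cmDatum L 3 (Matrix.of fun i j : Fin 3 => if i.val + j.val + 1 = 3 then (1 : L) else 0)).Local v),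
        c ∈ S ↔ (((Quotient.out c : ((cmDatum L 3 (Matrix.of fun i j : Fin 3 => if i.val + j.val + 1 = 3 then (1 : L) else 0)).Local v)).val : GL (Fin 3) (UnitaryGroup.LocalRing L v)).val - 1) ^ 3 = 0 :=
  Literature.NumberTheory.Rogawski1990.unitaryThree_unipotent_conjClasses_finite_odd

set_option maxHeartbeats 400000 in
-- statement-heavy: four instance binders
/-- **ORGAN ‹RAO-REG› `stub_RaoRegular` — PAID ★ p849508 (ED. v7): `:= UnitaryGroup.integrable_descConj_of_isLocSmooth_of_regular_unipotent` (LH7-p01 (g2) (C) ED. 3, binders token for token).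
Statement KEPT byte-identical (v7pre∕v7a) — text = the `hregCase` binder of
★ p849278 `UnitaryGroup.integrable_descConj_of_isLocSmooth_of_unipotent_of_cases` VERBATIM (= LH5-p02 (g2)'s head of record `UnitaryGroup.integrable_descConj_of_isLocSmooth_of_regular_unipotent`,
LH4-plan (g2) DEALER WORDS #25 (a)): HCONV prefix, `(hγ : n(γ)^3 = 0) (hreg : n(γ)^2 ≠ 0)`, then for every invariant `μ` finite on compacta and every `f ∈ C_c^∞(G)` the orbital
integrand is integrable.  Road in flight (REGULAR team: (I) ★ p849367, (II-C) ★ p849393, (A1) ★ p849396, (A2) ★ p849366, (II-S) LH7-p03, (II-E) LH5-p02, (B) LH4-p03, (C) LH7-p01).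
[cite: Rao1972, Theorem] [cite: Rogawski1990, §8.1 p. 112; §4.9 p. 54] [cite: HarishChandra1999AdmissibleDistributions, §3.1 p. 17] -/
theorem stub_RaoRegular :
    ∀ (L : Type) [Field L] [NumberField L] [IsCMField L] (v : HeightOneSpectrum (𝓞 ↥(maximalRealSubfield L))) (w : UnitaryGroup.PlacesOver L v),
    Subsingleton (UnitaryGroup.PlacesOver L v) → IsUnit (2 : 𝒪[w.1.adicCompletion L]) →
    ∀ [MeasurableSpace ((cmDatum L 3 (Matrix.of fun i j : Fin 3 => if i.val + j.val + 1 = 3 then (1 : L) else 0)).Local v)] [BorelSpace ((cmDatum L 3 (Matrix.of fun i j : Fin 3 => if i.val + j.val + 1 = 3 then (1 : L) else 0)).Local v)]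
      [∀ γ : ((cmDatum L 3 (Matrix.of fun i j : Fin 3 => if i.val + j.val + 1 = 3 then (1 : L) else 0)).Local v), MeasurableSpace (((cmDatum L 3 (Matrix.of fun i j : Fin 3 => if i.val + j.val + 1 = 3 then (1 : L) else 0)).Local v) ⧸ Subgroup.centralizer ({γ} : Set ((cmDatum L 3 (Matrix.of fun i j : Fin 3 => if i.val + j.val + 1 = 3 then (1 : L) else 0)).Local v)))]
      [∀ γ : ((cmDatum L 3 (Matrix.of fun i j : Fin 3 => if i.val + j.val + 1 = 3 then (1 : L) else 0)).Local v), BorelSpace (((cmDatum L 3 (Matrix.of fun i j : Fin 3 => if i.val + j.val + 1 = 3 then (1 : L) else 0)).Local v) ⧸ Subgroup.centralizer ({γ} : Set ((cmDatum L 3 (Matrix.of fun i j : Fin 3 => if i.val + j.val + 1 = 3 then (1 : L) else 0)).Local v)))],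
    ∀ (γ : ((cmDatum L 3 (Matrix.of fun i j : Fin 3 => if i.val + j.val + 1 = 3 then (1 : L) else 0)).Local v)),
      ((γ.val : GL (Fin 3) (UnitaryGroup.LocalRing L v)).val - 1) ^ 3 = 0 →
      ((γ.val : GL (Fin 3) (UnitaryGroup.LocalRing L v)).val - 1) ^ 2 ≠ 0 →
      ∀ (μ : Measure (((cmDatum L 3 (Matrix.of fun i j : Fin 3 => if i.val + j.val + 1 = 3 then (1 : L) else 0)).Local v) ⧸ (Subgroup.centralizer ({γ} : Set ((cmDatum L 3 (Matrix.of fun i j : Fin 3 => if i.val + j.val + 1 = 3 then (1 : L) else 0)).Local v)))))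
        [SMulInvariantMeasure ((cmDatum L 3 (Matrix.of fun i j : Fin 3 => if i.val + j.val + 1 = 3 then (1 : L) else 0)).Local v) (((cmDatum L 3 (Matrix.of fun i j : Fin 3 => if i.val + j.val + 1 = 3 then (1 : L) else 0)).Local v) ⧸ (Subgroup.centralizer ({γ} : Set ((cmDatum L 3 (Matrix.of fun i j : Fin 3 => if i.val + j.val + 1 = 3 then (1 : L) else 0)).Local v)))) μ] [IsFiniteMeasureOnCompacts μ],
      ∀ f : ((cmDatum L 3 (Matrix.of fun i j : Fin 3 => if i.val + j.val + 1 = 3 then (1 : L) else 0)).Local v) → ℂ, IsLocSmooth f →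
        Integrable (descConj γ (Subgroup.centralizer ({γ} : Set ((cmDatum L 3 (Matrix.of fun i j : Fin 3 => if i.val + j.val + 1 = 3 then (1 : L) else 0)).Local v))) (fun _ hg => Subgroup.mem_centralizer_singleton_iff.1 hg) f) μ :=
  UnitaryGroup.integrable_descConj_of_isLocSmooth_of_regular_unipotent

set_option maxHeartbeats 400000 in
-- statement-heavy: four instance binders
/-- **ORGAN ‹RAO-CONV› `stub_RaoConv` — PROVED (ED. v7pre) from ‹RAO-REG› and the ★ SINGULAR case**: ★ p849278's three-way split `…_of_unipotent_of_cases` (`γ = 1` ∕ regular ∕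
transvection) fed with `stub_RaoRegular` and ★ p849351 `UnitaryGroup.integrable_descConj_of_isLocSmooth_of_transvection` (LH10-p01 (g2), over ★ p849314 F0P3a-p09 + ★ p849303).
TEXT = F0P3a-p09 (g4)'s FILE 4 head `UnitaryGroup.integrable_descConj_of_isLocSmooth_of_unipotent` (LH3-p02 RAO-TIE 779faa6f `hconv` VERBATIM); when LH7-p01's FILE 4 ED. 2 is ★ this
becomes `:= that` (v7).  [cite: Rao1972, Theorem] [cite: Rogawski1990, §8.1 p. 112; §4.9 p. 54] [cite: HarishChandra1999AdmissibleDistributions, §3.1 p. 17] -/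
theorem stub_RaoConv :
    ∀ (L : Type) [Field L] [NumberField L] [IsCMField L] (v : HeightOneSpectrum (𝓞 ↥(maximalRealSubfield L))) (w : UnitaryGroup.PlacesOver L v),
    Subsingleton (UnitaryGroup.PlacesOver L v) → IsUnit (2 : 𝒪[w.1.adicCompletion L]) →
    ∀ [MeasurableSpace ((cmDatum L 3 (Matrix.of fun i j : Fin 3 => if i.val + j.val + 1 = 3 then (1 : L) else 0)).Local v)] [BorelSpace ((cmDatum L 3 (Matrix.of fun i j : Fin 3 => if i.val + j.val + 1 = 3 then (1 : L) else 0)).Local v)]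
      [∀ γ : ((cmDatum L 3 (Matrix.of fun i j : Fin 3 => if i.val + j.val + 1 = 3 then (1 : L) else 0)).Local v), MeasurableSpace (((cmDatum L 3 (Matrix.of fun i j : Fin 3 => if i.val + j.val + 1 = 3 then (1 : L) else 0)).Local v) ⧸ Subgroup.centralizer ({γ} : Set ((cmDatum L 3 (Matrix.of fun i j : Fin 3 => if i.val + j.val + 1 = 3 then (1 : L) else 0)).Local v)))]
      [∀ γ : ((cmDatum L 3 (Matrix.of fun i j : Fin 3 => if i.val + j.val + 1 = 3 then (1 : L) else 0)).Local v), BorelSpace (((cmDatum L 3 (Matrix.of fun i j : Fin 3 => if i.val + j.val + 1 = 3 then (1 : L) else 0)).Local v) ⧸ Subgroup.centralizer ({γ} : Set ((cmDatum L 3 (Matrix.of fun i j : Fin 3 => if i.val + j.val + 1 = 3 then (1 : L) else 0)).Local v)))],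
    ∀ (u : ((cmDatum L 3 (Matrix.of fun i j : Fin 3 => if i.val + j.val + 1 = 3 then (1 : L) else 0)).Local v)),
      (((u.val : GL (Fin 3) (UnitaryGroup.LocalRing L v)).val - 1) ^ 3 = 0) →
      ∀ (μ : Measure (((cmDatum L 3 (Matrix.of fun i j : Fin 3 => if i.val + j.val + 1 = 3 then (1 : L) else 0)).Local v) ⧸ Subgroup.centralizer ({u} : Set ((cmDatum L 3 (Matrix.of fun i j : Fin 3 => if i.val + j.val + 1 = 3 then (1 : L) else 0)).Local v))))
        [SMulInvariantMeasure ((cmDatum L 3 (Matrix.of fun i j : Fin 3 => if i.val + j.val + 1 = 3 then (1 : L) else 0)).Local v)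
          (((cmDatum L 3 (Matrix.of fun i j : Fin 3 => if i.val + j.val + 1 = 3 then (1 : L) else 0)).Local v) ⧸ Subgroup.centralizer ({u} : Set ((cmDatum L 3 (Matrix.of fun i j : Fin 3 => if i.val + j.val + 1 = 3 then (1 : L) else 0)).Local v))) μ]
        [IsFiniteMeasureOnCompacts μ],
      ∀ f : ((cmDatum L 3 (Matrix.of fun i j : Fin 3 => if i.val + j.val + 1 = 3 then (1 : L) else 0)).Local v) → ℂ, IsLocSmooth f →
        Integrable (descConj u (Subgroup.centralizer ({u} : Set ((cmDatum L 3 (Matrix.of fun i j : Fin 3 => if i.val + j.val + 1 = 3 then (1 : L) else 0)).Local v)))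
          (fun _ hg => Subgroup.mem_centralizer_singleton_iff.1 hg) f) μ :=
  fun L _ _ _ v w hsub h2 _ _ _ _ u hu μ _ _ f hf =>
    UnitaryGroup.integrable_descConj_of_isLocSmooth_of_unipotent_of_cases stub_RaoRegular
      (fun L _ _ _ v w hsub _ _ _ _ _ γ _ hsing hγ1 μ _ _ f hf => UnitaryGroup.integrable_descConj_of_isLocSmooth_of_transvection L v w hsub γ hsing hγ1 μ f hf)
      L v w hsub h2 u hu μ f hf

set_option maxHeartbeats 400000 in
-- statement-heavy: four instance binders
/-- **ORGAN ‹RAO› `stub_ShRao_of_conv` — PROVED from ‹RAO-CONV› (ED. v4∕v5; was the sorried `stub_ShRao` of v1–v3): existence UNCONDITIONAL by ★ p849258 RAO-EX-UNCOND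
`UnitaryGroup.exists_orbitalMeasureFamily_isAdmissibleOn_unipotent_antidiagOne_three_odd'` (LH4-p03 (g3); = ★ p849138 §3 `…_odd` ∘ ★ p849215 CENT-BDD), the Rao clause from
`stub_RaoConv` at `(Quotient.out u, mU u)` — LH3-p02 (g0)'s RAO-TIE glue 779faa6f verbatim.
ORIGINAL ORGAN TEXT (print basis [Rao1972])** — at an odd non-split place there is an orbital-measure family `mU` on `G = U(Φ₃)(L⁺_v)` ADMISSIBLE at
every unipotent class (non-zero, `G`-invariant, finite on compacts on `G ⧸ G_u`) with the RANGA-RAO CLAUSE: `y ↦ f(y u y⁻¹)` is `mU u`-integrable for every `f ∈ C_c^∞(G)` and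
every unipotent class `u`.  Road: existence ★ `InvariantQuotientExistence` over the unimodularity of the three centraliser types; convergence by the level decomposition of
`O_u ∩ K` (★ `exists_conj_cornerUnipotent_of_v_eq_mul_exp`) and the `Ad`-scaling law of the transported Haar measure of `G_u` (geometric series).
[cite: Rao1972, Theorem] [cite: Rogawski1990, §8.1 p. 112; §4.9 p. 54] [cite: HarishChandra1999AdmissibleDistributions, §3.1 p. 17] -/
theorem stub_ShRao_of_conv :
    ∀ (L : Type) [Field L] [NumberField L] [IsCMField L] (v : HeightOneSpectrum (𝓞 ↥(maximalRealSubfield L))) (w : UnitaryGroup.PlacesOver L v),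
      Subsingleton (UnitaryGroup.PlacesOver L v) → IsUnit (2 : 𝒪[w.1.adicCompletion L]) →
      ∀ [MeasurableSpace ((cmDatum L 3 (Matrix.of fun i j : Fin 3 => if i.val + j.val + 1 = 3 then (1 : L) else 0)).Local v)] [BorelSpace ((cmDatum L 3 (Matrix.of fun i j : Fin 3 => if i.val + j.val + 1 = 3 then (1 : L) else 0)).Local v)]
        [∀ γ : ((cmDatum L 3 (Matrix.of fun i j : Fin 3 => if i.val + j.val + 1 = 3 then (1 : L) else 0)).Local v), MeasurableSpace (((cmDatum L 3 (Matrix.of fun i j : Fin 3 => if i.val + j.val + 1 = 3 then (1 : L) else 0)).Local v) ⧸ Subgroup.centralizer ({γ} : Set ((cmDatum L 3 (Matrix.of fun i j : Fin 3 => if i.val + j.val + 1 = 3 then (1 : L) else 0)).Local v)))]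
        [∀ γ : ((cmDatum L 3 (Matrix.of fun i j : Fin 3 => if i.val + j.val + 1 = 3 then (1 : L) else 0)).Local v), BorelSpace (((cmDatum L 3 (Matrix.of fun i j : Fin 3 => if i.val + j.val + 1 = 3 then (1 : L) else 0)).Local v) ⧸ Subgroup.centralizer ({γ} : Set ((cmDatum L 3 (Matrix.of fun i j : Fin 3 => if i.val + j.val + 1 = 3 then (1 : L) else 0)).Local v)))],
      ∃ mU : OrbitalMeasureFamily ((cmDatum L 3 (Matrix.of fun i j : Fin 3 => if i.val + j.val + 1 = 3 then (1 : L) else 0)).Local v),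
        mU.IsAdmissibleOn (fun γ : ((cmDatum L 3 (Matrix.of fun i j : Fin 3 => if i.val + j.val + 1 = 3 then (1 : L) else 0)).Local v) => (((γ).val : GL (Fin 3) (UnitaryGroup.LocalRing L v)).val - 1) ^ 3 = 0) ∧
        ∀ u : ConjClasses ((cmDatum L 3 (Matrix.of fun i j : Fin 3 => if i.val + j.val + 1 = 3 then (1 : L) else 0)).Local v), (((Quotient.out u : ((cmDatum L 3 (Matrix.of fun i j : Fin 3 => if i.val + j.val + 1 = 3 then (1 : L) else 0)).Local v)).val : GL (Fin 3) (UnitaryGroup.LocalRing L v)).val - 1) ^ 3 = 0 →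
          ∀ f : ((cmDatum L 3 (Matrix.of fun i j : Fin 3 => if i.val + j.val + 1 = 3 then (1 : L) else 0)).Local v) → ℂ, IsLocSmooth f →
            Integrable (descConj (Quotient.out u : ((cmDatum L 3 (Matrix.of fun i j : Fin 3 => if i.val + j.val + 1 = 3 then (1 : L) else 0)).Local v)) (Subgroup.centralizer ({(Quotient.out u : ((cmDatum L 3 (Matrix.of fun i j : Fin 3 => if i.val + j.val + 1 = 3 then (1 : L) else 0)).Local v))} : Set ((cmDatum L 3 (Matrix.of fun i j : Fin 3 => if i.val + j.val + 1 = 3 then (1 : L) else 0)).Local v)))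
              (fun _ hg => Subgroup.mem_centralizer_singleton_iff.1 hg) f) (mU u) := by
  intro L _ _ _ v w hsub h2 _ _ _ _
  obtain ⟨mU, hmU, -⟩ := UnitaryGroup.exists_orbitalMeasureFamily_isAdmissibleOn_unipotent_antidiagOne_three_odd' L v w hsub h2
  refine ⟨mU, hmU, fun u hu f hf => ?_⟩
  obtain ⟨-, hinv, hfin⟩ := hmU u hu
  haveI := hinv
  haveI := hfin
  exact stub_RaoConv L v w hsub h2 (Quotient.out u) hu (mU u) f hf

set_option maxHeartbeats 400000 in
-- statement-heavy: four instance binders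
/-- **ORGAN ‹DUAL› `stub_ShDual` (IN-HOUSE, M at odd places)** — DUAL PIECES: for a finite set `S` of unipotent classes of `G = U(Φ₃)(L⁺_v)` and `mU` admissible on `S` with the
Rao clause there are `fd u ∈ C_c^∞(G)` (`u ∈ S`) with `Φ_{mU}(u, fd u) = 1` and `Φ_{mU}(u, fd u′) = 0` (`u ≠ u′`).  Road: ★ RANK `exists_levelPieces_det_classOrbitalIntegral_ne_zero`
(unramified; `Φ₃` has good reduction ★ `isUnit_placeForm_antidiagOne`) ∕ ★ `UnipotentOrbitalIntegralLevelPiecesRamifiedCM` (tame) + ★ p848130 `OrbitalIntegralDualPieces`.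
[cite: Rogawski1990, §8.1 p. 113] [cite: HarishChandra1999AdmissibleDistributions, §3.1 p. 17] -/
theorem stub_ShDual :
    ∀ (L : Type) [Field L] [NumberField L] [IsCMField L] (v : HeightOneSpectrum (𝓞 ↥(maximalRealSubfield L))) (w : UnitaryGroup.PlacesOver L v),
      Subsingleton (UnitaryGroup.PlacesOver L v) → IsUnit (2 : 𝒪[w.1.adicCompletion L]) →
      ∀ [MeasurableSpace ((cmDatum L 3 (Matrix.of fun i j : Fin 3 => if i.val + j.val + 1 = 3 then (1 : L) else 0)).Local v)] [BorelSpace ((cmDatum L 3 (Matrix.of fun i j : Fin 3 => if i.val + j.val + 1 = 3 then (1 : L) else 0)).Local v)]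
        [∀ γ : ((cmDatum L 3 (Matrix.of fun i j : Fin 3 => if i.val + j.val + 1 = 3 then (1 : L) else 0)).Local v), MeasurableSpace (((cmDatum L 3 (Matrix.of fun i j : Fin 3 => if i.val + j.val + 1 = 3 then (1 : L) else 0)).Local v) ⧸ Subgroup.centralizer ({γ} : Set ((cmDatum L 3 (Matrix.of fun i j : Fin 3 => if i.val + j.val + 1 = 3 then (1 : L) else 0)).Local v)))]
        [∀ γ : ((cmDatum L 3 (Matrix.of fun i j : Fin 3 => if i.val + j.val + 1 = 3 then (1 : L) else 0)).Local v), BorelSpace (((cmDatum L 3 (Matrix.of fun i j : Fin 3 => if i.val + j.val + 1 = 3 then (1 : L) else 0)).Local v) ⧸ Subgroup.centralizer ({γ} : Set ((cmDatum L 3 (Matrix.of fun i j : Fin 3 => if i.val + j.val + 1 = 3 then (1 : L) else 0)).Local v)))],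
      ∀ (S : Finset (ConjClasses ((cmDatum L 3 (Matrix.of fun i j : Fin 3 => if i.val + j.val + 1 = 3 then (1 : L) else 0)).Local v))) (mU : OrbitalMeasureFamily ((cmDatum L 3 (Matrix.of fun i j : Fin 3 => if i.val + j.val + 1 = 3 then (1 : L) else 0)).Local v)),
        (∀ u ∈ S, (((Quotient.out u : ((cmDatum L 3 (Matrix.of fun i j : Fin 3 => if i.val + j.val + 1 = 3 then (1 : L) else 0)).Local v)).val : GL (Fin 3) (UnitaryGroup.LocalRing L v)).val - 1) ^ 3 = 0) →
        mU.IsAdmissibleOn (fun γ : ((cmDatum L 3 (Matrix.of fun i j : Fin 3 => if i.val + j.val + 1 = 3 then (1 : L) else 0)).Local v) => (ConjClasses.mk γ) ∈ S) →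
        (∀ u ∈ S, ∀ f : ((cmDatum L 3 (Matrix.of fun i j : Fin 3 => if i.val + j.val + 1 = 3 then (1 : L) else 0)).Local v) → ℂ, IsLocSmooth f →
            Integrable (descConj (Quotient.out u : ((cmDatum L 3 (Matrix.of fun i j : Fin 3 => if i.val + j.val + 1 = 3 then (1 : L) else 0)).Local v)) (Subgroup.centralizer ({(Quotient.out u : ((cmDatum L 3 (Matrix.of fun i j : Fin 3 => if i.val + j.val + 1 = 3 then (1 : L) else 0)).Local v))} : Set ((cmDatum L 3 (Matrix.of fun i j : Fin 3 => if i.val + j.val + 1 = 3 then (1 : L) else 0)).Local v)))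
              (fun _ hg => Subgroup.mem_centralizer_singleton_iff.1 hg) f) (mU u)) →
        ∃ fd : ConjClasses ((cmDatum L 3 (Matrix.of fun i j : Fin 3 => if i.val + j.val + 1 = 3 then (1 : L) else 0)).Local v) → ((cmDatum L 3 (Matrix.of fun i j : Fin 3 => if i.val + j.val + 1 = 3 then (1 : L) else 0)).Local v) → ℂ,
          (∀ u ∈ S, IsLocSmooth (fd u)) ∧ (∀ u ∈ S, classOrbitalIntegral mU (fd u) u = 1) ∧
          (∀ u ∈ S, ∀ u' ∈ S, u ≠ u' → classOrbitalIntegral mU (fd u') u = 0) :=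
  Literature.NumberTheory.Rogawski1990.UnitaryGroup.exists_unipotentDualPieces_antidiagOne_odd

set_option maxHeartbeats 400000 in
-- statement-heavy: long ∀-closed generic text
/-- **ORGAN ‹SPAN-E› `stub_SpanE` — DISCHARGED (ED. v5) by ★ p849233 `Literature.MeasureTheory.Group.exists_add_mem_span_conj_sub_of_classOrbitalIntegral_eq_zero` (LH7-p01 (g2), SPAN-e FILE B;
telescope `(P)(S)(hS)(hP)(hfilt)(mU)(hmU)(hRao)(F)(hF)(h0)` + 12 instance binders match the `hE` text TOKEN FOR TOKEN — `intro … ; exact`, no η-bridge).  TEXT (kept as typed in v4: LH7-p01's head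
∀-CLOSED over `G : Type`, text = LH3-p02 (g0)'s SPAN-TIE rehearsal `hE` binder e342085f ll. 313–325 VERBATIM = LH4-plan (g2) deal text 04:21:32Z; print basis [Howe1974 Prop. 2] ∕
[HarishChandra1999AdmissibleDistributions Thm. 8.1])** — HOWE'S SPAN PROPERTY for ANY t.d. locally compact second-countable group `G`, a finite set `S` of classes cut out by a
conjugation-invariant predicate `P` with a CLOSED FILTRATION by partial unions, an orbital-measure family admissible on `S` with the Rao clause: `F ∈ C_c^∞(G)` with vanishing
`S`-orbital integrals is `F₀ + F₁`, `F₀ ∈ span {φ^x − φ}`, `tsupport F₁ ⊆ {¬P}`.  Road (LH7-p01, FILE A ★ p849206 + FILE B): COINV-1 ★ p849044 on each stratum, LIFT-EXACT ★ p849142,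
induction down the closed filtration.
[cite: Howe1974, Prop. 2] [cite: HarishChandra1999AdmissibleDistributions, Thm. 8.1 p. 48] [cite: BernsteinZelevinsky1976, §1.18] [cite: Rogawski1990, §8.1 pp. 112–113] -/
theorem stub_SpanE :
    ∀ {G : Type} [Group G] [TopologicalSpace G] [IsTopologicalGroup G] [LocallyCompactSpace G] [T2Space G] [TotallyDisconnectedSpace G]
    [SecondCountableTopology G] [MeasurableSpace G] [BorelSpace G]
    [∀ γ : G, MeasurableSpace (G ⧸ Subgroup.centralizer ({γ} : Set G))] [∀ γ : G, BorelSpace (G ⧸ Subgroup.centralizer ({γ} : Set G))]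
    (P : G → Prop) (S : Finset (ConjClasses G)) (hS : ∀ c, c ∈ S ↔ P (Quotient.out c)) (hP : ∀ g x : G, P (x * g * x⁻¹) ↔ P g)
    (hfilt : ∃ (n : ℕ) (e : Fin n → ConjClasses G), (∀ c, c ∈ S ↔ ∃ i, e i = c) ∧ ∀ k : ℕ, IsClosed (⋃ (i : Fin n) (_ : i.val < k), (e i).carrier))
    (mU : OrbitalMeasureFamily G) (hmU : mU.IsAdmissibleOn (fun γ : G => ConjClasses.mk γ ∈ S))
    (hRao : ∀ u ∈ S, ∀ f : G → ℂ, IsLocSmooth f →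
      Integrable (descConj (Quotient.out u : G) (Subgroup.centralizer {(Quotient.out u : G)}) (fun _ hg => Subgroup.mem_centralizer_singleton_iff.1 hg) f) (mU u))
    (F : G → ℂ) (hF : IsLocSmooth F) (h0 : ∀ u ∈ S, classOrbitalIntegral mU F u = 0),
    ∃ F₀ F₁ : G → ℂ, F = F₀ + F₁ ∧
      F₀ ∈ Submodule.span ℂ {ψ : G → ℂ | ∃ (x : G) (φ : G → ℂ), IsLocSmooth φ ∧ ψ = (fun g => φ (x * g * x⁻¹)) - φ} ∧
      ∀ g ∈ tsupport F₁, ¬ P g := by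
  intro G _ _ _ _ _ _ _ _ _ _ _ P S hS hP hfilt mU hmU hRao F hF h0
  exact exists_add_mem_span_conj_sub_of_classOrbitalIntegral_eq_zero P S hS hP hfilt mU hmU hRao F hF h0

set_option maxHeartbeats 400000 in
-- statement-heavy: four instance binders
/-- **ORGAN ‹SPAN› `stub_ShSpan_of_spanE` — PROVED from ‹SPAN-E› (ED. v4; was the sorried `stub_ShSpan` of v1–v3): LH3-p02 (g0)'s SPAN-TIE v2 BY IMPORT: ★ p849265 `exists_enum_unipotent_isClosed_iUnion_lt_antidiagOne_odd`
(`hfilt` unconditional, over ★ p849223 U3-STRATA (S1)∕(S2) and ★ p849243 `ClosedFiltrationEnumeration`) + ★ `npow_conj_sub_one_eq_zero_iff` fed to `stub_SpanE` (= ★ p849233).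
ORIGINAL ORGAN TEXT (print basis [Howe1974 Prop. 2] ∕ [HarishChandra1999AdmissibleDistributions Thm. 8.1])** — HOWE'S SPAN PROPERTY for
`G = U(Φ₃)(L⁺_v)` at an odd non-split place, for `S` = THE set of unipotent classes and `mU` admissible on `S` with the Rao clause: every `F ∈ C_c^∞(G)` whose unipotent orbital
integrals all vanish is `F₀ + F₁`, `F₀ ∈ span_ℂ {φ^x − φ}` (`φ ∈ C_c^∞`), `tsupport F₁` off the unipotent variety.  Road (elementary for a finite orbit stratification): COINV-1
(one orbit: `∫ ψ dμ_O = 0 ⇒ ψ ∈ span (φ^x − φ)`), ORBIT-OPEN (Baire), U3-STRATA (`{1} ⊂ {(γ−1)²=0} ⊂ {(γ−1)³=0}`), LIFT (★ `exists_isLocallyConstant_hasCompactSupport_extend`),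
INDUCTION along the strata (`Φ(u, φ^x − φ) = 0`: ★ SH-2 `classOrbitalIntegral_eq_zero_of_mem_span_conj_sub`).
[cite: Howe1974, Prop. 2] [cite: HarishChandra1999AdmissibleDistributions, Thm. 8.1 p. 48] [cite: BernsteinZelevinsky1976, §1.5] [cite: Rogawski1990, §8.1 pp. 112–113] -/
theorem stub_ShSpan_of_spanE :
    ∀ (L : Type) [Field L] [NumberField L] [IsCMField L] (v : HeightOneSpectrum (𝓞 ↥(maximalRealSubfield L))) (w : UnitaryGroup.PlacesOver L v),
      Subsingleton (UnitaryGroup.PlacesOver L v) → IsUnit (2 : 𝒪[w.1.adicCompletion L]) →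
      ∀ [MeasurableSpace ((cmDatum L 3 (Matrix.of fun i j : Fin 3 => if i.val + j.val + 1 = 3 then (1 : L) else 0)).Local v)] [BorelSpace ((cmDatum L 3 (Matrix.of fun i j : Fin 3 => if i.val + j.val + 1 = 3 then (1 : L) else 0)).Local v)]
        [∀ γ : ((cmDatum L 3 (Matrix.of fun i j : Fin 3 => if i.val + j.val + 1 = 3 then (1 : L) else 0)).Local v), MeasurableSpace (((cmDatum L 3 (Matrix.of fun i j : Fin 3 => if i.val + j.val + 1 = 3 then (1 : L) else 0)).Local v) ⧸ Subgroup.centralizer ({γ} : Set ((cmDatum L 3 (Matrix.of fun i j : Fin 3 => if i.val + j.val + 1 = 3 then (1 : L) else 0)).Local v)))]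
        [∀ γ : ((cmDatum L 3 (Matrix.of fun i j : Fin 3 => if i.val + j.val + 1 = 3 then (1 : L) else 0)).Local v), BorelSpace (((cmDatum L 3 (Matrix.of fun i j : Fin 3 => if i.val + j.val + 1 = 3 then (1 : L) else 0)).Local v) ⧸ Subgroup.centralizer ({γ} : Set ((cmDatum L 3 (Matrix.of fun i j : Fin 3 => if i.val + j.val + 1 = 3 then (1 : L) else 0)).Local v)))],
      ∀ (S : Finset (ConjClasses ((cmDatum L 3 (Matrix.of fun i j : Fin 3 => if i.val + j.val + 1 = 3 then (1 : L) else 0)).Local v))) (mU : OrbitalMeasureFamily ((cmDatum L 3 (Matrix.of fun i j : Fin 3 => if i.val + j.val + 1 = 3 then (1 : L) else 0)).Local v)),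
        (∀ c : ConjClasses ((cmDatum L 3 (Matrix.of fun i j : Fin 3 => if i.val + j.val + 1 = 3 then (1 : L) else 0)).Local v), c ∈ S ↔ (((Quotient.out c : ((cmDatum L 3 (Matrix.of fun i j : Fin 3 => if i.val + j.val + 1 = 3 then (1 : L) else 0)).Local v)).val : GL (Fin 3) (UnitaryGroup.LocalRing L v)).val - 1) ^ 3 = 0) →
        mU.IsAdmissibleOn (fun γ : ((cmDatum L 3 (Matrix.of fun i j : Fin 3 => if i.val + j.val + 1 = 3 then (1 : L) else 0)).Local v) => (ConjClasses.mk γ) ∈ S) →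
        (∀ u ∈ S, ∀ f : ((cmDatum L 3 (Matrix.of fun i j : Fin 3 => if i.val + j.val + 1 = 3 then (1 : L) else 0)).Local v) → ℂ, IsLocSmooth f →
            Integrable (descConj (Quotient.out u : ((cmDatum L 3 (Matrix.of fun i j : Fin 3 => if i.val + j.val + 1 = 3 then (1 : L) else 0)).Local v)) (Subgroup.centralizer ({(Quotient.out u : ((cmDatum L 3 (Matrix.of fun i j : Fin 3 => if i.val + j.val + 1 = 3 then (1 : L) else 0)).Local v))} : Set ((cmDatum L 3 (Matrix.of fun i j : Fin 3 => if i.val + j.val + 1 = 3 then (1 : L) else 0)).Local v)))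
              (fun _ hg => Subgroup.mem_centralizer_singleton_iff.1 hg) f) (mU u)) →
        ∀ F : ((cmDatum L 3 (Matrix.of fun i j : Fin 3 => if i.val + j.val + 1 = 3 then (1 : L) else 0)).Local v) → ℂ, IsLocSmooth F → (∀ u ∈ S, classOrbitalIntegral mU F u = 0) →
          ∃ F₀ F₁ : ((cmDatum L 3 (Matrix.of fun i j : Fin 3 => if i.val + j.val + 1 = 3 then (1 : L) else 0)).Local v) → ℂ, F = F₀ + F₁ ∧
            F₀ ∈ Submodule.span ℂ {ψ : ((cmDatum L 3 (Matrix.of fun i j : Fin 3 => if i.val + j.val + 1 = 3 then (1 : L) else 0)).Local v) → ℂ |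
              ∃ (x : ((cmDatum L 3 (Matrix.of fun i j : Fin 3 => if i.val + j.val + 1 = 3 then (1 : L) else 0)).Local v)) (φ : ((cmDatum L 3 (Matrix.of fun i j : Fin 3 => if i.val + j.val + 1 = 3 then (1 : L) else 0)).Local v) → ℂ), IsLocSmooth φ ∧ ψ = (fun g => φ (x * g * x⁻¹)) - φ} ∧
            ∀ g ∈ tsupport F₁, (((g).val : GL (Fin 3) (UnitaryGroup.LocalRing L v)).val - 1) ^ 3 ≠ 0 := by
  -- LH3-p02 (g0)'s SPAN-TIE v2 (rehearsal 72e04e1569450791) BY IMPORT: `hfilt` is ★ p849265 `exists_enum_unipotent_isClosed_iUnion_lt_antidiagOne_odd`, fed to `stub_SpanE`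
  -- (= ★ p849233) at `P γ := (γ − 1)³ = 0`; the `𝒪[L_w]` spelling bridge (w6: leaf dialect `ValuativeRel` → ★ p849265's `Valued`) is the ONE term ★ p849331
  -- `isUnit_two_valuedInteger_of_isUnit_two L w.1 h2` (LH3-p02's «𝒪-BRIDGE», SPAN-TIE v3 e93e35fdb76cfa84 verbatim).
  intro L _ _ _ v w hsub h2 _ _ _ _ S mU hS hmU hRao F hF h0
  haveI : TotallyDisconnectedSpace ((cmDatum L 3 (Matrix.of fun i j : Fin 3 => if i.val + j.val + 1 = 3 then (1 : L) else 0)).Local v) :=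
    totallyDisconnectedSpace_cmDatum_local L 3 _ v
  obtain ⟨n, e, he, hcl⟩ := exists_enum_unipotent_isClosed_iUnion_lt_antidiagOne_odd L v w hsub (isUnit_two_valuedInteger_of_isUnit_two L w.1 h2) S hS
  exact stub_SpanE (fun γ : ((cmDatum L 3 (Matrix.of fun i j : Fin 3 => if i.val + j.val + 1 = 3 then (1 : L) else 0)).Local v) => ((γ.val : GL (Fin 3) (UnitaryGroup.LocalRing L v)).val - 1) ^ 3 = 0) S hS
    (fun g x => npow_conj_sub_one_eq_zero_iff L _ v g x 3) ⟨n, e, he, hcl⟩ mU hmU hRao F hF h0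

/-! ## §2 HEAD — the NARROWED row `N6nsShalikaOddStatement` from the four organs through the ★ SH-3 plug -/

set_option maxHeartbeats 800000 in
-- statement-heavy: four organ texts as hypotheses
/-- **HEAD `n6nsShalikaOdd_of_organs` (PROVED): ‹U-FIN› → ‹RAO› → ‹DUAL› → ‹SPAN› → «Shalika at `Φ₃` at every ODD non-split place»** (= `N6nsShalikaOddStatement` of the cand
`LocalTransferIdentityCoreResidualStatementsOdd`, by `Iff.rfl`): at `(L, v)` take `S` from ‹U-FIN›, `mU` from ‹RAO› (admissible on `S` because `c ∈ S ↔ γ_c` unipotent and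
`⟦γ_c⟧ = c`), `fd` from ‹DUAL›, the span property from ‹SPAN›, and apply ★ `UnitaryGroup.shalikaGermExpansionNonsplit_of_howePackage` with ★ `antidiagOne_isHermitian L 3`,
★ `(isUnit_antidiagOne_det L 3).ne_zero`.
[cite: Rogawski1990, §8.1 Prop. 8.1.1 pp. 112–113] [cite: Howe1974, Prop. 2] [cite: Rao1972] -/
theorem n6nsShalikaOdd_of_organs
    (hfin :
    ∀ (L : Type) [Field L] [NumberField L] [IsCMField L] (v : HeightOneSpectrum (𝓞 ↥(maximalRealSubfield L))) (w : UnitaryGroup.PlacesOver L v),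
      Subsingleton (UnitaryGroup.PlacesOver L v) → IsUnit (2 : 𝒪[w.1.adicCompletion L]) →
      ∃ S : Finset (ConjClasses ((cmDatum L 3 (Matrix.of fun i j : Fin 3 => if i.val + j.val + 1 = 3 then (1 : L) else 0)).Local v)), ∀ c : ConjClasses ((cmDatum L 3 (Matrix.of fun i j : Fin 3 => if i.val + j.val + 1 = 3 then (1 : L) else 0)).Local v),
        c ∈ S ↔ (((Quotient.out c : ((cmDatum L 3 (Matrix.of fun i j : Fin 3 => if i.val + j.val + 1 = 3 then (1 : L) else 0)).Local v)).val : GL (Fin 3) (UnitaryGroup.LocalRing L v)).val - 1) ^ 3 = 0)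
    (hrao :
    ∀ (L : Type) [Field L] [NumberField L] [IsCMField L] (v : HeightOneSpectrum (𝓞 ↥(maximalRealSubfield L))) (w : UnitaryGroup.PlacesOver L v),
      Subsingleton (UnitaryGroup.PlacesOver L v) → IsUnit (2 : 𝒪[w.1.adicCompletion L]) →
      ∀ [MeasurableSpace ((cmDatum L 3 (Matrix.of fun i j : Fin 3 => if i.val + j.val + 1 = 3 then (1 : L) else 0)).Local v)] [BorelSpace ((cmDatum L 3 (Matrix.of fun i j : Fin 3 => if i.val + j.val + 1 = 3 then (1 : L) else 0)).Local v)]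
        [∀ γ : ((cmDatum L 3 (Matrix.of fun i j : Fin 3 => if i.val + j.val + 1 = 3 then (1 : L) else 0)).Local v), MeasurableSpace (((cmDatum L 3 (Matrix.of fun i j : Fin 3 => if i.val + j.val + 1 = 3 then (1 : L) else 0)).Local v) ⧸ Subgroup.centralizer ({γ} : Set ((cmDatum L 3 (Matrix.of fun i j : Fin 3 => if i.val + j.val + 1 = 3 then (1 : L) else 0)).Local v)))]
        [∀ γ : ((cmDatum L 3 (Matrix.of fun i j : Fin 3 => if i.val + j.val + 1 = 3 then (1 : L) else 0)).Local v), BorelSpace (((cmDatum L 3 (Matrix.of fun i j : Fin 3 => if i.val + j.val + 1 = 3 then (1 : L) else 0)).Local v) ⧸ Subgroup.centralizer ({γ} : Set ((cmDatum L 3 (Matrix.of fun i j : Fin 3 => if i.val + j.val + 1 = 3 then (1 : L) else 0)).Local v)))],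
      ∃ mU : OrbitalMeasureFamily ((cmDatum L 3 (Matrix.of fun i j : Fin 3 => if i.val + j.val + 1 = 3 then (1 : L) else 0)).Local v),
        mU.IsAdmissibleOn (fun γ : ((cmDatum L 3 (Matrix.of fun i j : Fin 3 => if i.val + j.val + 1 = 3 then (1 : L) else 0)).Local v) => (((γ).val : GL (Fin 3) (UnitaryGroup.LocalRing L v)).val - 1) ^ 3 = 0) ∧
        ∀ u : ConjClasses ((cmDatum L 3 (Matrix.of fun i j : Fin 3 => if i.val + j.val + 1 = 3 then (1 : L) else 0)).Local v), (((Quotient.out u : ((cmDatum L 3 (Matrix.of fun i j : Fin 3 => if i.val + j.val + 1 = 3 then (1 : L) else 0)).Local v)).val : GL (Fin 3) (UnitaryGroup.LocalRing L v)).val - 1) ^ 3 = 0 →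
          ∀ f : ((cmDatum L 3 (Matrix.of fun i j : Fin 3 => if i.val + j.val + 1 = 3 then (1 : L) else 0)).Local v) → ℂ, IsLocSmooth f →
            Integrable (descConj (Quotient.out u : ((cmDatum L 3 (Matrix.of fun i j : Fin 3 => if i.val + j.val + 1 = 3 then (1 : L) else 0)).Local v)) (Subgroup.centralizer ({(Quotient.out u : ((cmDatum L 3 (Matrix.of fun i j : Fin 3 => if i.val + j.val + 1 = 3 then (1 : L) else 0)).Local v))} : Set ((cmDatum L 3 (Matrix.of fun i j : Fin 3 => if i.val + j.val + 1 = 3 then (1 : L) else 0)).Local v)))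
              (fun _ hg => Subgroup.mem_centralizer_singleton_iff.1 hg) f) (mU u))
    (hdual :
    ∀ (L : Type) [Field L] [NumberField L] [IsCMField L] (v : HeightOneSpectrum (𝓞 ↥(maximalRealSubfield L))) (w : UnitaryGroup.PlacesOver L v),
      Subsingleton (UnitaryGroup.PlacesOver L v) → IsUnit (2 : 𝒪[w.1.adicCompletion L]) →
      ∀ [MeasurableSpace ((cmDatum L 3 (Matrix.of fun i j : Fin 3 => if i.val + j.val + 1 = 3 then (1 : L) else 0)).Local v)] [BorelSpace ((cmDatum L 3 (Matrix.of fun i j : Fin 3 => if i.val + j.val + 1 = 3 then (1 : L) else 0)).Local v)]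
        [∀ γ : ((cmDatum L 3 (Matrix.of fun i j : Fin 3 => if i.val + j.val + 1 = 3 then (1 : L) else 0)).Local v), MeasurableSpace (((cmDatum L 3 (Matrix.of fun i j : Fin 3 => if i.val + j.val + 1 = 3 then (1 : L) else 0)).Local v) ⧸ Subgroup.centralizer ({γ} : Set ((cmDatum L 3 (Matrix.of fun i j : Fin 3 => if i.val + j.val + 1 = 3 then (1 : L) else 0)).Local v)))]
        [∀ γ : ((cmDatum L 3 (Matrix.of fun i j : Fin 3 => if i.val + j.val + 1 = 3 then (1 : L) else 0)).Local v), BorelSpace (((cmDatum L 3 (Matrix.of fun i j : Fin 3 => if i.val + j.val + 1 = 3 then (1 : L) else 0)).Local v) ⧸ Subgroup.centralizer ({γ} : Set ((cmDatum L 3 (Matrix.of fun i j : Fin 3 => if i.val + j.val + 1 = 3 then (1 : L) else 0)).Local v)))],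
      ∀ (S : Finset (ConjClasses ((cmDatum L 3 (Matrix.of fun i j : Fin 3 => if i.val + j.val + 1 = 3 then (1 : L) else 0)).Local v))) (mU : OrbitalMeasureFamily ((cmDatum L 3 (Matrix.of fun i j : Fin 3 => if i.val + j.val + 1 = 3 then (1 : L) else 0)).Local v)),
        (∀ u ∈ S, (((Quotient.out u : ((cmDatum L 3 (Matrix.of fun i j : Fin 3 => if i.val + j.val + 1 = 3 then (1 : L) else 0)).Local v)).val : GL (Fin 3) (UnitaryGroup.LocalRing L v)).val - 1) ^ 3 = 0) →
        mU.IsAdmissibleOn (fun γ : ((cmDatum L 3 (Matrix.of fun i j : Fin 3 => if i.val + j.val + 1 = 3 then (1 : L) else 0)).Local v) => (ConjClasses.mk γ) ∈ S) →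
        (∀ u ∈ S, ∀ f : ((cmDatum L 3 (Matrix.of fun i j : Fin 3 => if i.val + j.val + 1 = 3 then (1 : L) else 0)).Local v) → ℂ, IsLocSmooth f →
            Integrable (descConj (Quotient.out u : ((cmDatum L 3 (Matrix.of fun i j : Fin 3 => if i.val + j.val + 1 = 3 then (1 : L) else 0)).Local v)) (Subgroup.centralizer ({(Quotient.out u : ((cmDatum L 3 (Matrix.of fun i j : Fin 3 => if i.val + j.val + 1 = 3 then (1 : L) else 0)).Local v))} : Set ((cmDatum L 3 (Matrix.of fun i j : Fin 3 => if i.val + j.val + 1 = 3 then (1 : L) else 0)).Local v)))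
              (fun _ hg => Subgroup.mem_centralizer_singleton_iff.1 hg) f) (mU u)) →
        ∃ fd : ConjClasses ((cmDatum L 3 (Matrix.of fun i j : Fin 3 => if i.val + j.val + 1 = 3 then (1 : L) else 0)).Local v) → ((cmDatum L 3 (Matrix.of fun i j : Fin 3 => if i.val + j.val + 1 = 3 then (1 : L) else 0)).Local v) → ℂ,
          (∀ u ∈ S, IsLocSmooth (fd u)) ∧ (∀ u ∈ S, classOrbitalIntegral mU (fd u) u = 1) ∧
          (∀ u ∈ S, ∀ u' ∈ S, u ≠ u' → classOrbitalIntegral mU (fd u') u = 0))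
    (hspan :
    ∀ (L : Type) [Field L] [NumberField L] [IsCMField L] (v : HeightOneSpectrum (𝓞 ↥(maximalRealSubfield L))) (w : UnitaryGroup.PlacesOver L v),
      Subsingleton (UnitaryGroup.PlacesOver L v) → IsUnit (2 : 𝒪[w.1.adicCompletion L]) →
      ∀ [MeasurableSpace ((cmDatum L 3 (Matrix.of fun i j : Fin 3 => if i.val + j.val + 1 = 3 then (1 : L) else 0)).Local v)] [BorelSpace ((cmDatum L 3 (Matrix.of fun i j : Fin 3 => if i.val + j.val + 1 = 3 then (1 : L) else 0)).Local v)]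
        [∀ γ : ((cmDatum L 3 (Matrix.of fun i j : Fin 3 => if i.val + j.val + 1 = 3 then (1 : L) else 0)).Local v), MeasurableSpace (((cmDatum L 3 (Matrix.of fun i j : Fin 3 => if i.val + j.val + 1 = 3 then (1 : L) else 0)).Local v) ⧸ Subgroup.centralizer ({γ} : Set ((cmDatum L 3 (Matrix.of fun i j : Fin 3 => if i.val + j.val + 1 = 3 then (1 : L) else 0)).Local v)))]
        [∀ γ : ((cmDatum L 3 (Matrix.of fun i j : Fin 3 => if i.val + j.val + 1 = 3 then (1 : L) else 0)).Local v), BorelSpace (((cmDatum L 3 (Matrix.of fun i j : Fin 3 => if i.val + j.val + 1 = 3 then (1 : L) else 0)).Local v) ⧸ Subgroup.centralizer ({γ} : Set ((cmDatum L 3 (Matrix.of fun i j : Fin 3 => if i.val + j.val + 1 = 3 then (1 : L) else 0)).Local v)))],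
      ∀ (S : Finset (ConjClasses ((cmDatum L 3 (Matrix.of fun i j : Fin 3 => if i.val + j.val + 1 = 3 then (1 : L) else 0)).Local v))) (mU : OrbitalMeasureFamily ((cmDatum L 3 (Matrix.of fun i j : Fin 3 => if i.val + j.val + 1 = 3 then (1 : L) else 0)).Local v)),
        (∀ c : ConjClasses ((cmDatum L 3 (Matrix.of fun i j : Fin 3 => if i.val + j.val + 1 = 3 then (1 : L) else 0)).Local v), c ∈ S ↔ (((Quotient.out c : ((cmDatum L 3 (Matrix.of fun i j : Fin 3 => if i.val + j.val + 1 = 3 then (1 : L) else 0)).Local v)).val : GL (Fin 3) (UnitaryGroup.LocalRing L v)).val - 1) ^ 3 = 0) →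
        mU.IsAdmissibleOn (fun γ : ((cmDatum L 3 (Matrix.of fun i j : Fin 3 => if i.val + j.val + 1 = 3 then (1 : L) else 0)).Local v) => (ConjClasses.mk γ) ∈ S) →
        (∀ u ∈ S, ∀ f : ((cmDatum L 3 (Matrix.of fun i j : Fin 3 => if i.val + j.val + 1 = 3 then (1 : L) else 0)).Local v) → ℂ, IsLocSmooth f →
            Integrable (descConj (Quotient.out u : ((cmDatum L 3 (Matrix.of fun i j : Fin 3 => if i.val + j.val + 1 = 3 then (1 : L) else 0)).Local v)) (Subgroup.centralizer ({(Quotient.out u : ((cmDatum L 3 (Matrix.of fun i j : Fin 3 => if i.val + j.val + 1 = 3 then (1 : L) else 0)).Local v))} : Set ((cmDatum L 3 (Matrix.of fun i j : Fin 3 => if i.val + j.val + 1 = 3 then (1 : L) else 0)).Local v)))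
              (fun _ hg => Subgroup.mem_centralizer_singleton_iff.1 hg) f) (mU u)) →
        ∀ F : ((cmDatum L 3 (Matrix.of fun i j : Fin 3 => if i.val + j.val + 1 = 3 then (1 : L) else 0)).Local v) → ℂ, IsLocSmooth F → (∀ u ∈ S, classOrbitalIntegral mU F u = 0) →
          ∃ F₀ F₁ : ((cmDatum L 3 (Matrix.of fun i j : Fin 3 => if i.val + j.val + 1 = 3 then (1 : L) else 0)).Local v) → ℂ, F = F₀ + F₁ ∧
            F₀ ∈ Submodule.span ℂ {ψ : ((cmDatum L 3 (Matrix.of fun i j : Fin 3 => if i.val + j.val + 1 = 3 then (1 : L) else 0)).Local v) → ℂ |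
              ∃ (x : ((cmDatum L 3 (Matrix.of fun i j : Fin 3 => if i.val + j.val + 1 = 3 then (1 : L) else 0)).Local v)) (φ : ((cmDatum L 3 (Matrix.of fun i j : Fin 3 => if i.val + j.val + 1 = 3 then (1 : L) else 0)).Local v) → ℂ), IsLocSmooth φ ∧ ψ = (fun g => φ (x * g * x⁻¹)) - φ} ∧
            ∀ g ∈ tsupport F₁, (((g).val : GL (Fin 3) (UnitaryGroup.LocalRing L v)).val - 1) ^ 3 ≠ 0) :
    ∀ (L : Type) [Field L] [NumberField L] [IsCMField L] (v : HeightOneSpectrum (𝓞 ↥(maximalRealSubfield L))) (w : UnitaryGroup.PlacesOver L v),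
      Subsingleton (UnitaryGroup.PlacesOver L v) → IsUnit (2 : 𝒪[w.1.adicCompletion L]) →
        ShalikaGermExpansionNonsplit L (Matrix.of fun i j : Fin 3 => if i.val + j.val + 1 = 3 then (1 : L) else 0) v := by
  intro L _ _ _ v w hsub h2
  refine UnitaryGroup.shalikaGermExpansionNonsplit_of_howePackage L (Matrix.of fun i j : Fin 3 => if i.val + j.val + 1 = 3 then (1 : L) else 0) v
    (antidiagOne_isHermitian L 3) (isUnit_antidiagOne_det L 3).ne_zero ?_
  intro _ _ _ _
  obtain ⟨S, hS⟩ := hfin L v w hsub h2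
  obtain ⟨mU, hadm, hraoU⟩ := hrao L v w hsub h2
  have hmk : ∀ c : ConjClasses ((cmDatum L 3 (Matrix.of fun i j : Fin 3 => if i.val + j.val + 1 = 3 then (1 : L) else 0)).Local v), ConjClasses.mk (Quotient.out c) = c := fun c => Quotient.out_eq c
  have hunip : ∀ u ∈ S, (((Quotient.out u : ((cmDatum L 3 (Matrix.of fun i j : Fin 3 => if i.val + j.val + 1 = 3 then (1 : L) else 0)).Local v)).val : GL (Fin 3) (UnitaryGroup.LocalRing L v)).val - 1) ^ 3 = 0 :=
    fun u hu => (hS u).1 hu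
  have hadmS : mU.IsAdmissibleOn (fun γ : ((cmDatum L 3 (Matrix.of fun i j : Fin 3 => if i.val + j.val + 1 = 3 then (1 : L) else 0)).Local v) => (ConjClasses.mk γ) ∈ S) := by
    intro c hc
    have hc' : c ∈ S := by simpa only [hmk] using hc
    exact hadm c ((hS c).1 hc')
  have hraoS : ∀ u ∈ S, ∀ f : ((cmDatum L 3 (Matrix.of fun i j : Fin 3 => if i.val + j.val + 1 = 3 then (1 : L) else 0)).Local v) → ℂ, IsLocSmooth f →
            Integrable (descConj (Quotient.out u : ((cmDatum L 3 (Matrix.of fun i j : Fin 3 => if i.val + j.val + 1 = 3 then (1 : L) else 0)).Local v)) (Subgroup.centralizer ({(Quotient.out u : ((cmDatum L 3 (Matrix.of fun i j : Fin 3 => if i.val + j.val + 1 = 3 then (1 : L) else 0)).Local v))} : Set ((cmDatum L 3 (Matrix.of fun i j : Fin 3 => if i.val + j.val + 1 = 3 then (1 : L) else 0)).Local v)))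
              (fun _ hg => Subgroup.mem_centralizer_singleton_iff.1 hg) f) (mU u) :=
    fun u hu => hraoU u (hunip u hu)
  obtain ⟨fd, hfd, h1, h0⟩ := hdual L v w hsub h2 S mU hunip hadmS hraoS
  exact ⟨S, mU, fd, hunip, hadmS, hraoS, hfd, h1, h0, hspan L v w hsub h2 S mU hS hadmS hraoS⟩

/-- **`stub_N6nsShalikaOdd_of_organs`** — the NARROWED row over the four stubs (closes `stub_N6nsShalika : N6nsShalikaOddStatement` by `exact` once the narrowing is adopted).
[cite: Rogawski1990, §8.1 Prop. 8.1.1 p. 112] -/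
theorem stub_N6nsShalikaOdd_of_organs :
    ∀ (L : Type) [Field L] [NumberField L] [IsCMField L] (v : HeightOneSpectrum (𝓞 ↥(maximalRealSubfield L))) (w : UnitaryGroup.PlacesOver L v),
      Subsingleton (UnitaryGroup.PlacesOver L v) → IsUnit (2 : 𝒪[w.1.adicCompletion L]) →
        ShalikaGermExpansionNonsplit L (Matrix.of fun i j : Fin 3 => if i.val + j.val + 1 = 3 then (1 : L) else 0) v :=
  n6nsShalikaOdd_of_organs stub_ShUFin stub_ShRao_of_conv stub_ShDual stub_ShSpan_of_spanE

/-- **`stub_N6nsShalikaOdd_paid : N6nsShalikaOddStatement`** — THE PAID HEAD BY NAME (desk F0P3-plan (g14) condition (c), LH4-plan (g2) DEALER WORDS #48∕#49): the narrowed row's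
TYPE ★ `Literature.NumberTheory.Rogawski1990.N6nsShalikaOddStatement` (p849113; the socket ED. 39 §2‴ exposes it as `stub_N6nsShalika`), closed by `stub_N6nsShalikaOdd_of_organs`
(definitional unfolding).  `--axioms` = TRIO ∪ {sorryAx} through EXACTLY `stub_RaoRegular`. [cite: Rogawski1990, §8.1 Prop. 8.1.1 p. 112] -/
theorem stub_N6nsShalikaOdd_paid : Literature.NumberTheory.Rogawski1990.N6nsShalikaOddStatement :=
  stub_N6nsShalikaOdd_of_organs

end Summit.HodgeConjecture.HodgeConjecture.Cruxes.H413.F0P3cShalikaPaydown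

end
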